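import Literature.NumberTheory.Automorphic.HidaLatticeLevelControlTwoOrd
import Literature.NumberTheory.Automorphic.HidaEngineBridge
import Literature.NumberTheory.Automorphic.HidaEngineDiamondUnipotent
import Mathlib.RingTheory.Finiteness.Ideal
import HarnessLib

/-!
# Descent of ordinary lattice classes from the engine level to the base level

Topic `NumberTheory/Automorphic`; namespace `Literature.NumberTheory.Automorphic.BigHeckeGLn.TameLevel`;
theorems only (no named fact, no `sorry`).

Hida's control of the `U_p`-ordinary cohomology of the lattice `⨂_τ Sym^{k−2}((O/pⁿ)²)` between the
ENGINE level `W = U(lv n, max(lv n, 1))` of `HidaEngineModules`/`HidaEngineBridge` and the BASE level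
`U₀ = U(b₁, b₁)` (`e_v c₀ ≤ b₁ ≤ lv n`, `1 ≤ b₁`), through `U = U(c,c) ⊴ U' = U(b₁,c)` (`c = max(lv n,1)`;
`U = W` as sets): the inputs of the levelwise support engine.

* generic helpers: `resCohomology_mem_ordAtΔ`, `trCohomology_mem_ordAtΔ` (`res`, `tr` between Hida
  levels preserve ordinarity), `commute_up_up_depthLevel` (the `U_{w,1}` commute at mixed-depth
  levels — hypothesis `hcomm` of `HidaLevelOrdinaryBijection`), `resCohomology_resCohomology_of_le_of_le`
  (transport between two presentations of the same level);
* `engRed_uniformizer_pow_eq_zero` — `red_τ(ϖ_τ)^{lv n} = 0` (the exponent of the weight bridge);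
* **`exists_latPolyHom_eq_sum_two`** — for `s ∈ O[Syms]` killing `H²(U₀, Sym)` and `y ∈ Ord H²(W, Sym)`:
  `π(s) y = ∑_q π(X_{d_q} − 1) b_q` with ordinary `b_q` (tr-equivariance, Hida's bijection in the top
  degree, the ordinary B4);
* **`exists_eq_smul_add_sum_two`** — an ordinary `y ∈ H²(W)` with `tr(res y) ∈ ϖ·Ord H²(U')` is
  `ϖ y'' + ∑_q π(X_{d_q} − 1) b_q`;
* **`exists_mem_ordAtΔ_res_eq_one`** — an ordinary `y ∈ H¹(W, Sym)` fixed by the `π(X_{d_q})` is `res`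
  of an ordinary class of `H¹(U₀, Sym)` (B1/B2, Hida's bijection in degree one);
* `injOn_resCohomology_ordAtΔ_one_base` — `res : Ord H¹(U₀) → H¹(W)` is injective.

[cite: Hida1994AIF, §3, Thm 3.2] [cite: KhareThorne2017, §6.3, Prop. 6.6, Lemma 6.10; §6.5]

## References

* H. Hida, Ann. Inst. Fourier 44 (1994), §2–3 (held). [Hida1994AIF]
* C. Khare, J. A. Thorne, Amer. J. Math. 139 (2017), §6.3–6.5 (arXiv:1409.7007, held). [KhareThorne2017]
-/

noncomputable section

open CategoryTheory IsDedekindDomain MvPolynomial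
open scoped NumberField

namespace Literature.NumberTheory.Automorphic

namespace BigHeckeGLn

namespace TameLevel

open IntegralWeightGL2 LevelAction ParallelWeight

variable {K : Type} [Field K] [NumberField K] {p : ℕ} [Fact p.Prime] (𝒰 : TameLevel 2 K p)

/-! ### Generic helpers -/

section Generic

variable {R : Type} [CommRing R] {V : Type} [AddCommGroup V] [Module R V]
  {E : Type} [Field E] {v : (K →+* E) → HeightOneSpectrum (𝓞 K)} (hv : ∀ τ, (p : 𝓞 K) ∈ (v τ).asIdeal)
  (τ : integralMonoid K v →* Module.End R V) (h𝒰 : 𝒰.IsMaximalAbove)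

include h𝒰 in
/-- **`res` between Hida levels maps ordinary classes to ordinary classes.** [folklore] -/
theorem resCohomology_mem_ordAtΔ {b₁ c₁ b₂ c₂ : ℕ} (hle : 𝒰.level b₂ c₂ ≤ 𝒰.level b₁ c₁) (hc₁ : 1 ≤ c₁) (hc₂ : 1 ≤ c₂)
    (i : ℕ) {x : cohomology (globalEmbedding 2 K) (integralMonoid K v) τ (𝒰.level b₁ c₁) i}
    (hx : x ∈ ordAtΔ (globalEmbedding 2 K) (integralMonoid K v) τ
      (fun w : PlacesAbove K p => heckeElement_mem_integralMonoid v w.1 1) (𝒰.level_le_integralMonoid_of_forall_mem hv b₁ c₁) i) :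
    (resCohomology (globalEmbedding 2 K) (integralMonoid K v) τ hle i).hom x ∈
      ordAtΔ (globalEmbedding 2 K) (integralMonoid K v) τ
        (fun w : PlacesAbove K p => heckeElement_mem_integralMonoid v w.1 1) (𝒰.level_le_integralMonoid_of_forall_mem hv b₂ c₂) i := by
  simp only [ordAtΔ, Submodule.mem_iInf] at hx ⊢
  intro w
  exact (Submodule.mem_iInf _).1 (mapsTo_iInf_range_pow_of_comp_eq
    (𝒰.resCohomology_comp_heckeCohomology_level (Δ := integralMonoid K v) τ h𝒰
      (𝒰.level_le_integralMonoid_of_forall_mem hv b₁ c₁) (𝒰.level_le_integralMonoid_of_forall_mem hv b₂ c₂) hle hc₁ hc₂ i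
      (𝒰.heckeElement_mem_hidaElements (Or.inr w.2) 1) (heckeElement_mem_integralMonoid v w.1 1))
    ((Submodule.mem_iInf _).2 (hx w)))

include hv in
/-- **`U(b, c_•)` lies in the integral monoid** of every family of places above `p`. [folklore] -/
theorem depthLevel_le_integralMonoid_of_forall_mem (b : ℕ) (cv : PlacesAbove K p → ℕ) :
    (𝒰.depthLevel b cv).toSubmonoid ≤ integralMonoid K v := fun u hu =>
  (mem_integralMonoid_iff u).2 fun τ i j => by
    have hloc := ((𝒰.mem_levelAt_iff _ u).1 hu).2 (v τ) (hv τ)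
    exact (HeightOneSpectrum.mem_adicCompletionIntegers (R := 𝓞 K) K _).2
      ((mem_valuedIwahoriSubgroup_iff.1 hloc).1.le_one i j)

include h𝒰 in
/-- **`tr` between Hida levels maps ordinary classes to ordinary classes.** [folklore] -/
theorem trCohomology_mem_ordAtΔ {b' b c : ℕ} (hb : b' ≤ b) (hbc : b ≤ c) (hc : 1 ≤ c) (i : ℕ)
    {x : cohomology (globalEmbedding 2 K) (integralMonoid K v) τ (𝒰.level b c) i}
    (hx : x ∈ ordAtΔ (globalEmbedding 2 K) (integralMonoid K v) τ
      (fun w : PlacesAbove K p => heckeElement_mem_integralMonoid v w.1 1) (𝒰.level_le_integralMonoid_of_forall_mem hv b c) i) :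
    (trCohomology (globalEmbedding 2 K) (integralMonoid K v) τ (𝒰.level_le_integralMonoid_of_forall_mem hv b c)
        (𝒰.level_le_integralMonoid_of_forall_mem hv b' c) i).hom x ∈
      ordAtΔ (globalEmbedding 2 K) (integralMonoid K v) τ
        (fun w : PlacesAbove K p => heckeElement_mem_integralMonoid v w.1 1) (𝒰.level_le_integralMonoid_of_forall_mem hv b' c) i := by
  simp only [ordAtΔ, Submodule.mem_iInf] at hx ⊢
  intro w
  exact (Submodule.mem_iInf _).1 (mapsTo_iInf_range_pow_of_comp_eq
    (𝒰.trCohomology_comp_heckeCohomology_level (Δ := integralMonoid K v) τ h𝒰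
      (𝒰.level_le_integralMonoid_of_forall_mem hv b c) (𝒰.level_le_integralMonoid_of_forall_mem hv b' c) hb hbc hc i
      (fun w hw x hx => 𝒰.globalUnipotent_mul_heckeElement_mem_integralMonoid h𝒰 hv hw hx)
      (fun w _ hp y => ofLocal_mem_integralMonoid v (fun τ h => hp (by rw [← h]; exact hv τ)) y)
      (𝒰.heckeElement_mem_hidaElements (Or.inr w.2) 1) (heckeElement_mem_integralMonoid v w.1 1))
    ((Submodule.mem_iInf _).2 (hx w)))

include h𝒰 in
/-- **The `U_{w,1}` pairwise commute at the mixed-depth levels `U(b, c_•)`** (hypothesis `hcomm` of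
`HidaLevelOrdinaryBijection`). [cite: KhareThorne2017, §6.2, Lemma 6.5 (1)] -/
theorem commute_up_up_depthLevel {Δ : Submonoid (FiniteAdelicGL 2 K)} (τ' : Δ →* Module.End R V)
    (hΔ : ∀ w : PlacesAbove K p, heckeElement 2 K w.1 1 ∈ Δ) (b : ℕ) (cv : PlacesAbove K p → ℕ)
    (hU : (𝒰.depthLevel b cv).toSubmonoid ≤ Δ) (i : ℕ) (w w' : PlacesAbove K p) :
    Commute (heckeCohomology (globalEmbedding 2 K) Δ τ' (𝒰.depthLevel b cv) hU (hΔ w) i)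
      (heckeCohomology (globalEmbedding 2 K) Δ τ' (𝒰.depthLevel b cv) hU (hΔ w') i) := by
  by_cases hww' : w = w'
  · subst hww'
    exact Commute.refl _
  · change _ * _ = _ * _
    have hne : w.1 ≠ w'.1 := fun h => hww' (Subtype.ext h)
    have hx := hΔ w
    have hy := hΔ w'
    rw [heckeElement_eq_ofLocal] at hx hy
    have hKw := 𝒰.isUnramifiedLevel_levelAt (Λ := fun u => iwahoriLevel 2 u.1 b (cv u)) h𝒰 w.2
      valuedIwahoriSubgroup_le_valuedCongruenceSubgroup_one
    have hKw' := 𝒰.isUnramifiedLevel_levelAt (Λ := fun u => iwahoriLevel 2 u.1 b (cv u)) h𝒰 w'.2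
      valuedIwahoriSubgroup_le_valuedCongruenceSubgroup_one
    have h := LevelAction.heckeCohomology_comm_of_orthogonal (globalEmbedding 2 K) τ' hU hKw hKw' hx hy
      (fun g => localComponent_ofLocal_of_ne (Ne.symm hne) g) i
    rw [LevelAction.heckeCohomology_congr (globalEmbedding 2 K) Δ τ' (𝒰.depthLevel b cv) hU (hΔ w) hx
        (heckeElement_eq_ofLocal w.1 1) i,
      LevelAction.heckeCohomology_congr (globalEmbedding 2 K) Δ τ' (𝒰.depthLevel b cv) hU (hΔ w') hy
        (heckeElement_eq_ofLocal w'.1 1) i]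
    exact h

/-- **Transport between two presentations of the same level**: `res_{A→B} (res_{B→A} x) = x` when `A ≤ B`
and `B ≤ A`. [folklore] -/
theorem resCohomology_resCohomology_of_le_of_le {Δ : Submonoid (FiniteAdelicGL 2 K)} (τ' : Δ →* Module.End R V)
    {A B : Subgroup (FiniteAdelicGL 2 K)} (hAB : A ≤ B) (hBA : B ≤ A) (i : ℕ)
    (x : cohomology (globalEmbedding 2 K) Δ τ' A i) :
    (resCohomology (globalEmbedding 2 K) Δ τ' hAB i).hom ((resCohomology (globalEmbedding 2 K) Δ τ' hBA i).hom x) = x := by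
  rw [← resCohomology_hom_comp' hBA hAB i x]
  exact resCohomology_hom_refl' i x

end Generic

/-! ### The engine level -/

section Engine

variable [h𝒰 : Fact 𝒰.IsMaximalAbove] (O : Type) [CommRing O] {E : Type} [Field E] [CharZero E] (lv : ℕ → ℕ)
  {v : (K →+* E) → HeightOneSpectrum (𝓞 K)} (hv : ∀ τ, (p : 𝓞 K) ∈ (v τ).asIdeal)
  (φO : ∀ τ : K →+* E, (v τ).adicCompletionIntegers K →+* O) (n : ℕ)
  (hred : ∀ τ (x : (v τ).adicCompletionIntegers K),
    Valued.v (x : (v τ).adicCompletion K) ≤ (WithZero.exp (-(lv n : ℤ)) : WithZero (Multiplicative ℤ)) →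
      engRed p O φO n τ x = 0)
  (k c₀ : ℕ) {b₁ : ℕ} (hb₁ : ∀ w : PlacesAbove K p, BigHeckeGLn.ordAt w.1 (p : 𝓞 K) * c₀ ≤ b₁)
  (hb₁1 : 1 ≤ b₁) (hlvn : b₁ ≤ lv n)

omit [Fact p.Prime] h𝒰 [CharZero E] in
include hred in
/-- `red_τ(ϖ_τ)^{lv n} = 0`: the exponent of the weight bridge. [folklore] -/
theorem engRed_uniformizer_pow_eq_zero (τ : K →+* E) :
    engRed p O φO n τ ⟨_, uniformizerAt_mem_adicCompletionIntegers K (v τ)⟩ ^ (lv n) = 0 := by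
  rw [← map_pow]
  refine hred τ _ ?_
  rw [SubmonoidClass.coe_pow, map_pow]
  change Valued.v (((uniformizerAt (v τ) : ((v τ).adicCompletion K)ˣ) : (v τ).adicCompletion K)) ^ (lv n) ≤ _
  rw [valued_coe_uniformizerAt, ← WithZero.exp_nsmul, nsmul_eq_mul, mul_neg, mul_one]

end Engine

/-! ### Abbreviations for the engine coefficient system at step `n` -/

/-- The lattice coefficients `⨂_τ Sym^{k−2}((O/pⁿ)²)` with the place maps modulo `pⁿ`. [folklore] -/
abbrev engLatAction (p : ℕ) (O : Type) [CommRing O] {E : Type} [Field E] [CharZero E]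
    {v : (K →+* E) → HeightOneSpectrum (𝓞 K)} (φO : ∀ τ : K →+* E, (v τ).adicCompletionIntegers K →+* O) (n k : ℕ) :
    integralMonoid K v →* Module.End (engCoeff p O n) (SymCoeffLattice (engCoeff p O n) E K k) :=
  symLatticeAction (engCoeff p O n) E K k v (engRed p O φO n)

section Engine

variable [h𝒰 : Fact 𝒰.IsMaximalAbove] (O : Type) [CommRing O] {E : Type} [Field E] [CharZero E] (lv : ℕ → ℕ)
  {v : (K →+* E) → HeightOneSpectrum (𝓞 K)} (hv : ∀ τ, (p : 𝓞 K) ∈ (v τ).asIdeal)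
  (φO : ∀ τ : K →+* E, (v τ).adicCompletionIntegers K →+* O) (n : ℕ)
  (hred : ∀ τ (x : (v τ).adicCompletionIntegers K),
    Valued.v (x : (v τ).adicCompletion K) ≤ (WithZero.exp (-(lv n : ℤ)) : WithZero (Multiplicative ℤ)) →
      engRed p O φO n τ x = 0)
  (k c₀ : ℕ) {b₁ : ℕ} (hb₁ : ∀ w : PlacesAbove K p, BigHeckeGLn.ordAt w.1 (p : 𝓞 K) * c₀ ≤ b₁)
  (hb₁1 : 1 ≤ b₁) (hlvn : b₁ ≤ lv n)

/-- **The polynomial action `π` of `O[Syms]` on `H^j(U(b,c), Sym((O/pⁿ)²))`.** [cite: KhareThorne2017, §6.5] -/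
abbrev levPolyHom (b c j : ℕ) :
    MvPolynomial (𝒰.Syms c₀) O →+* Module.End (engCoeff p O n)
      (cohomology (globalEmbedding 2 K) (integralMonoid K v) (engLatAction p O φO n k) (𝒰.level b c) j) :=
  𝒰.symPolyHom (engLatAction p O φO n k) (𝒰.level_le_integralMonoid_of_forall_mem hv b c) c₀
    (fun _ hg => 𝒰.goodElements_le_integralMonoid v hg) (fun u => diamondPi_mem_integralMonoid' v hv u)
    (Ideal.Quotient.mk _) h𝒰.out j

/-- **The `U_p`-ordinary part of `H^j(U(b,c), Sym((O/pⁿ)²))`.** [cite: KhareThorne2017, §2.4] -/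
abbrev levOrd (b c j : ℕ) :
    Submodule (engCoeff p O n) (cohomology (globalEmbedding 2 K) (integralMonoid K v) (engLatAction p O φO n k) (𝒰.level b c) j) :=
  ordAtΔ (globalEmbedding 2 K) (integralMonoid K v) (engLatAction p O φO n k)
    (fun w : PlacesAbove K p => heckeElement_mem_integralMonoid v w.1 1) (𝒰.level_le_integralMonoid_of_forall_mem hv b c) j

/-! ### Degree two -/

include hb₁1 hlvn in
/-- **For `s` killing `H²(U₀, Sym)` and `y ∈ Ord H²(W, Sym)`: `π(s) y = ∑_q π(X_{d_q} − 1) b_q` with ordinary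
`b_q`** (`W = U(lv n, c)`, `c = max(lv n, 1)`, `Q = U(b₁,c)/U(c,c)`).
[cite: Hida1994AIF, §3, Thm 3.2] [cite: KhareThorne2017, §6.3, Prop. 6.6; §6.5] -/
theorem exists_levPolyHom_eq_sum_two
    (hfin : ∀ (cv : PlacesAbove K p → ℕ) (i : ℕ),
      Finite (cohomology (globalEmbedding 2 K) (integralMonoid K v) (engLatAction p O φO n k) (𝒰.depthLevel b₁ cv) i))
    [Finite (cohomology (globalEmbedding 2 K) (integralMonoid K v) (engLatAction p O φO n k)
      (𝒰.level (max (lv n) 1) (max (lv n) 1)) 2)]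
    (hcd : ∀ (W : Subgroup (FiniteAdelicGL 2 K)),
      IsOpen (W : Set (FiniteAdelicGL 2 K)) → IsCompact (W : Set (FiniteAdelicGL 2 K)) →
      (∀ γ ∈ W.comap (globalEmbedding 2 K), IsOfFinOrder γ → γ = 1) →
      ∀ (A : Rep ℤ (W.comap (globalEmbedding 2 K))) (q : ℕ), 3 ≤ q → Subsingleton (groupCohomology A q))
    (htf : ∀ (x : FiniteAdelicGL 2 K) (γ : GL (Fin 2) K), IsOfFinOrder γ →
      x⁻¹ * globalEmbedding 2 K γ * x ∈ 𝒰.level b₁ (max (lv n) 1) → γ = 1)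
    (s : MvPolynomial (𝒰.Syms c₀) O)
    (hs : ∀ y₀ : cohomology (globalEmbedding 2 K) (integralMonoid K v) (engLatAction p O φO n k) (𝒰.level b₁ b₁) 2,
      𝒰.levPolyHom O hv φO n k c₀ b₁ b₁ 2 s y₀ = 0)
    (y : cohomology (globalEmbedding 2 K) (integralMonoid K v) (engLatAction p O φO n k) (𝒰.level (lv n) (max (lv n) 1)) 2)
    (hy : y ∈ 𝒰.levOrd O hv φO n k (lv n) (max (lv n) 1) 2) :
    ∃ b : (𝒰.level b₁ (max (lv n) 1) ⧸ (𝒰.level (max (lv n) 1) (max (lv n) 1)).subgroupOf (𝒰.level b₁ (max (lv n) 1))) →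
        cohomology (globalEmbedding 2 K) (integralMonoid K v) (engLatAction p O φO n k) (𝒰.level (lv n) (max (lv n) 1)) 2,
      (∀ q, b q ∈ 𝒰.levOrd O hv φO n k (lv n) (max (lv n) 1) 2) ∧
      𝒰.levPolyHom O hv φO n k c₀ (lv n) (max (lv n) 1) 2 s y =
        ∑ q, 𝒰.levPolyHom O hv φO n k c₀ (lv n) (max (lv n) 1) 2
          (X (Sum.inr (𝒰.torusSection h𝒰.out hb₁ (hlvn.trans (le_max_left _ _)) (le_max_right _ _) q)) - 1) (b q) := by
  classical
  haveI : Module.Free (engCoeff p O n) (SymCoeffLattice (engCoeff p O n) E K k) :=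
    Module.Free.of_basis (latticeBasis (engCoeff p O n) E K k)
  have h1 : 1 ≤ lv n := hb₁1.trans hlvn
  have hbc : b₁ ≤ max (lv n) 1 := hlvn.trans (le_max_left _ _)
  have hc : 1 ≤ max (lv n) 1 := le_max_right _ _
  haveI := 𝒰.normal_subgroupOf_level h𝒰.out hbc hc
  haveI : Finite (cohomology (globalEmbedding 2 K) (integralMonoid K v) (engLatAction p O φO n k)
      (𝒰.level b₁ (max (lv n) 1)) 2) := hfin (fun _ => max (lv n) 1) 2
  have hWU : 𝒰.level (lv n) (max (lv n) 1) ≤ 𝒰.level (max (lv n) 1) (max (lv n) 1) :=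
    𝒰.level_antitone (max_le le_rfl h1) le_rfl
  have hUW : 𝒰.level (max (lv n) 1) (max (lv n) 1) ≤ 𝒰.level (lv n) (max (lv n) 1) :=
    𝒰.level_antitone (le_max_left _ _) le_rfl
  -- `y₁ := res_{W→U} y` is ordinary
  have hy₁ : (resCohomology (globalEmbedding 2 K) (integralMonoid K v) (engLatAction p O φO n k) hUW 2).hom y ∈
      𝒰.levOrd O hv φO n k (max (lv n) 1) (max (lv n) 1) 2 :=
    𝒰.resCohomology_mem_ordAtΔ hv (engLatAction p O φO n k) h𝒰.out hUW hc hc 2 hy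
  -- `x := π s y₁` is ordinary with `tr x = 0`
  have hx : 𝒰.levPolyHom O hv φO n k c₀ (max (lv n) 1) (max (lv n) 1) 2 s
        ((resCohomology (globalEmbedding 2 K) (integralMonoid K v) (engLatAction p O φO n k) hUW 2).hom y) ∈
      𝒰.levOrd O hv φO n k (max (lv n) 1) (max (lv n) 1) 2 :=
    𝒰.symPolyHom_apply_mem_symOrd (engLatAction p O φO n k) (𝒰.level_le_integralMonoid_of_forall_mem hv (max (lv n) 1) (max (lv n) 1)) (Ideal.Quotient.mk _) h𝒰.out 2 s hy₁
  have htr : (trCohomology (globalEmbedding 2 K) (integralMonoid K v) (engLatAction p O φO n k) (𝒰.level_le_integralMonoid_of_forall_mem hv (max (lv n) 1) (max (lv n) 1)) (𝒰.level_le_integralMonoid_of_forall_mem hv b₁ (max (lv n) 1)) 2).hom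
      (𝒰.levPolyHom O hv φO n k c₀ (max (lv n) 1) (max (lv n) 1) 2 s
        ((resCohomology (globalEmbedding 2 K) (integralMonoid K v) (engLatAction p O φO n k) hUW 2).hom y)) = 0 := by
    rw [𝒰.trCohomology_symPolyHom_apply h𝒰.out hbc le_rfl hc hv (𝒰.level_le_integralMonoid_of_forall_mem hv (max (lv n) 1) (max (lv n) 1)) (𝒰.level_le_integralMonoid_of_forall_mem hv b₁ (max (lv n) 1)) (engLatAction p O φO n k) c₀ (Ideal.Quotient.mk _) 2 s _]
    have htr₁ := 𝒰.trCohomology_mem_ordAtΔ hv (engLatAction p O φO n k) h𝒰.out hbc le_rfl hc 2 hy₁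
    -- Hida's bijection in the top degree: `tr y₁ = res w₀`
    have hbij := bijOn_resCohomology_ordAtΔ (ι := globalEmbedding 2 K) (Δ := integralMonoid K v) (τ := (engLatAction p O φO n k))
      (hΔ := fun w : PlacesAbove K p => heckeElement_mem_integralMonoid v w.1 1)
      (hUΔ := fun cv => 𝒰.depthLevel_le_integralMonoid_of_forall_mem hv b₁ cv) h𝒰.out hfin
      (fun cv i w w' => 𝒰.commute_up_up_depthLevel h𝒰.out (engLatAction p O φO n k) (fun w : PlacesAbove K p => heckeElement_mem_integralMonoid v w.1 1)
        b₁ cv (𝒰.depthLevel_le_integralMonoid_of_forall_mem hv b₁ cv) i w w') hb₁1 le_rfl hbc 2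
    obtain ⟨w₀, -, hw₀⟩ := hbij.surjOn htr₁
    rw [← hw₀, ← 𝒰.resCohomology_symPolyHom_apply hv (engLatAction p O φO n k) h𝒰.out (𝒰.level_le_integralMonoid_of_forall_mem hv b₁ b₁) (𝒰.level_le_integralMonoid_of_forall_mem hv b₁ (max (lv n) 1)) (𝒰.level_antitone le_rfl hbc) hb₁1 hc c₀
      (Ideal.Quotient.mk _) 2 s w₀]
    change (resCohomology (globalEmbedding 2 K) (integralMonoid K v) (engLatAction p O φO n k) _ 2).hom (𝒰.levPolyHom O hv φO n k c₀ b₁ b₁ 2 s w₀) = 0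
    rw [hs w₀, map_zero]
  -- ordinary B4 at `U(c,c) ⊴ U(b₁,c)`
  obtain ⟨b, hb, hsum⟩ := 𝒰.exists_eq_sum_diamond_sub_of_mem_ordAtΔ_two hv (engLatAction p O φO n k) h𝒰.out hb₁ hbc hc hcd htf _ hx htr
  refine ⟨fun q => (resCohomology (globalEmbedding 2 K) (integralMonoid K v) (engLatAction p O φO n k) hWU 2).hom (b q),
    fun q => 𝒰.resCohomology_mem_ordAtΔ hv (engLatAction p O φO n k) h𝒰.out hWU hc hc 2 (hb q), ?_⟩
  -- transport back to `W`
  have hyback : (resCohomology (globalEmbedding 2 K) (integralMonoid K v) (engLatAction p O φO n k) hWU 2).hom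
      ((resCohomology (globalEmbedding 2 K) (integralMonoid K v) (engLatAction p O φO n k) hUW 2).hom y) = y :=
    resCohomology_resCohomology_of_le_of_le (engLatAction p O φO n k) hWU hUW 2 y
  have hres := 𝒰.resCohomology_symPolyHom_apply hv (engLatAction p O φO n k) h𝒰.out (𝒰.level_le_integralMonoid_of_forall_mem hv (max (lv n) 1) (max (lv n) 1)) (𝒰.level_le_integralMonoid_of_forall_mem hv (lv n) (max (lv n) 1)) hWU hc hc c₀ (Ideal.Quotient.mk _) 2 s
    ((resCohomology (globalEmbedding 2 K) (integralMonoid K v) (engLatAction p O φO n k) hUW 2).hom y)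
  conv_lhs => rw [← hyback]
  rw [← hres]
  change (resCohomology (globalEmbedding 2 K) (integralMonoid K v) (engLatAction p O φO n k) hWU 2).hom
      (𝒰.levPolyHom O hv φO n k c₀ (max (lv n) 1) (max (lv n) 1) 2 s
        ((resCohomology (globalEmbedding 2 K) (integralMonoid K v) (engLatAction p O φO n k) hUW 2).hom y)) = _
  rw [hsum, map_sum]
  refine Finset.sum_congr rfl fun q _ => ?_
  have hdiam := LinearMap.congr_fun (𝒰.resCohomology_comp_symOp hv (engLatAction p O φO n k) h𝒰.out (𝒰.level_le_integralMonoid_of_forall_mem hv (max (lv n) 1) (max (lv n) 1)) (𝒰.level_le_integralMonoid_of_forall_mem hv (lv n) (max (lv n) 1)) hWU hc hc c₀ 2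
    (Sum.inr (𝒰.torusSection h𝒰.out hb₁ hbc hc q))) (b q)
  rw [LinearMap.comp_apply, LinearMap.comp_apply, symOp_inr, symOp_inr] at hdiam
  simp only [map_sub, map_one, LinearMap.sub_apply, Module.End.one_apply, symPolyHom_X, symOp_inr]
  congr 1

include hb₁1 hlvn in
/-- **An ordinary `y ∈ H²(W, Sym)` with `tr (res y) ∈ ϖ · Ord H²(U')` is `ϖ y'' + ∑_q π(X_{d_q} − 1) b_q` with
`y''`, `b_q` ordinary.** [cite: KhareThorne2017, §6.3, Prop. 6.6] [cite: Hida1994AIF, §3, Thm 3.2] -/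
theorem exists_eq_smul_add_sum_two
    [Finite (cohomology (globalEmbedding 2 K) (integralMonoid K v) (engLatAction p O φO n k) (𝒰.level b₁ (max (lv n) 1)) 2)]
    [Finite (cohomology (globalEmbedding 2 K) (integralMonoid K v) (engLatAction p O φO n k)
      (𝒰.level (max (lv n) 1) (max (lv n) 1)) 2)]
    (hcd : ∀ (W : Subgroup (FiniteAdelicGL 2 K)),
      IsOpen (W : Set (FiniteAdelicGL 2 K)) → IsCompact (W : Set (FiniteAdelicGL 2 K)) →
      (∀ γ ∈ W.comap (globalEmbedding 2 K), IsOfFinOrder γ → γ = 1) →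
      ∀ (A : Rep ℤ (W.comap (globalEmbedding 2 K))) (q : ℕ), 3 ≤ q → Subsingleton (groupCohomology A q))
    (htf : ∀ (x : FiniteAdelicGL 2 K) (γ : GL (Fin 2) K), IsOfFinOrder γ →
      x⁻¹ * globalEmbedding 2 K γ * x ∈ 𝒰.level b₁ (max (lv n) 1) → γ = 1)
    (ϖ : engCoeff p O n)
    (y : cohomology (globalEmbedding 2 K) (integralMonoid K v) (engLatAction p O φO n k) (𝒰.level (lv n) (max (lv n) 1)) 2)
    (hy : y ∈ 𝒰.levOrd O hv φO n k (lv n) (max (lv n) 1) 2)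
    (hyϖ : ∃ a ∈ 𝒰.levOrd O hv φO n k b₁ (max (lv n) 1) 2,
      (trCohomology (globalEmbedding 2 K) (integralMonoid K v) (engLatAction p O φO n k)
          (𝒰.level_le_integralMonoid_of_forall_mem hv (max (lv n) 1) (max (lv n) 1))
          (𝒰.level_le_integralMonoid_of_forall_mem hv b₁ (max (lv n) 1)) 2).hom
        ((resCohomology (globalEmbedding 2 K) (integralMonoid K v) (engLatAction p O φO n k)
          (𝒰.level_antitone (le_max_left _ _) le_rfl :
            𝒰.level (max (lv n) 1) (max (lv n) 1) ≤ 𝒰.level (lv n) (max (lv n) 1)) 2).hom y) = ϖ • a) :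
    ∃ y'' ∈ 𝒰.levOrd O hv φO n k (lv n) (max (lv n) 1) 2,
      ∃ b : (𝒰.level b₁ (max (lv n) 1) ⧸ (𝒰.level (max (lv n) 1) (max (lv n) 1)).subgroupOf (𝒰.level b₁ (max (lv n) 1))) →
          cohomology (globalEmbedding 2 K) (integralMonoid K v) (engLatAction p O φO n k) (𝒰.level (lv n) (max (lv n) 1)) 2,
        (∀ q, b q ∈ 𝒰.levOrd O hv φO n k (lv n) (max (lv n) 1) 2) ∧
        y = ϖ • y'' + ∑ q, 𝒰.levPolyHom O hv φO n k c₀ (lv n) (max (lv n) 1) 2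
          (X (Sum.inr (𝒰.torusSection h𝒰.out hb₁ (hlvn.trans (le_max_left _ _)) (le_max_right _ _) q)) - 1) (b q) := by
  classical
  haveI : Module.Free (engCoeff p O n) (SymCoeffLattice (engCoeff p O n) E K k) :=
    Module.Free.of_basis (latticeBasis (engCoeff p O n) E K k)
  have h1 : 1 ≤ lv n := hb₁1.trans hlvn
  have hbc : b₁ ≤ max (lv n) 1 := hlvn.trans (le_max_left _ _)
  have hc : 1 ≤ max (lv n) 1 := le_max_right _ _
  haveI := 𝒰.normal_subgroupOf_level h𝒰.out hbc hc
  have hWU : 𝒰.level (lv n) (max (lv n) 1) ≤ 𝒰.level (max (lv n) 1) (max (lv n) 1) :=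
    𝒰.level_antitone (max_le le_rfl h1) le_rfl
  have hUW : 𝒰.level (max (lv n) 1) (max (lv n) 1) ≤ 𝒰.level (lv n) (max (lv n) 1) :=
    𝒰.level_antitone (le_max_left _ _) le_rfl
  have hy₁ : (resCohomology (globalEmbedding 2 K) (integralMonoid K v) (engLatAction p O φO n k) hUW 2).hom y ∈
      𝒰.levOrd O hv φO n k (max (lv n) 1) (max (lv n) 1) 2 :=
    𝒰.resCohomology_mem_ordAtΔ hv (engLatAction p O φO n k) h𝒰.out hUW hc hc 2 hy
  obtain ⟨x'', hx'', b, hb, hsum⟩ := 𝒰.exists_eq_smul_add_sum_of_mem_ordAtΔ_two hv (engLatAction p O φO n k) h𝒰.out hb₁ hbc hc hcd htf ϖ _ hy₁ hyϖ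
  refine ⟨(resCohomology (globalEmbedding 2 K) (integralMonoid K v) (engLatAction p O φO n k) hWU 2).hom x'',
    𝒰.resCohomology_mem_ordAtΔ hv (engLatAction p O φO n k) h𝒰.out hWU hc hc 2 hx'',
    fun q => (resCohomology (globalEmbedding 2 K) (integralMonoid K v) (engLatAction p O φO n k) hWU 2).hom (b q),
    fun q => 𝒰.resCohomology_mem_ordAtΔ hv (engLatAction p O φO n k) h𝒰.out hWU hc hc 2 (hb q), ?_⟩
  have hyback : (resCohomology (globalEmbedding 2 K) (integralMonoid K v) (engLatAction p O φO n k) hWU 2).hom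
      ((resCohomology (globalEmbedding 2 K) (integralMonoid K v) (engLatAction p O φO n k) hUW 2).hom y) = y :=
    resCohomology_resCohomology_of_le_of_le (engLatAction p O φO n k) hWU hUW 2 y
  conv_lhs => rw [← hyback, hsum]
  rw [map_add, map_smul, map_sum]
  congr 1
  refine Finset.sum_congr rfl fun q _ => ?_
  have hdiam := LinearMap.congr_fun (𝒰.resCohomology_comp_symOp hv (engLatAction p O φO n k) h𝒰.out (𝒰.level_le_integralMonoid_of_forall_mem hv (max (lv n) 1) (max (lv n) 1)) (𝒰.level_le_integralMonoid_of_forall_mem hv (lv n) (max (lv n) 1)) hWU hc hc c₀ 2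
    (Sum.inr (𝒰.torusSection h𝒰.out hb₁ hbc hc q))) (b q)
  rw [LinearMap.comp_apply, LinearMap.comp_apply, symOp_inr, symOp_inr] at hdiam
  simp only [map_sub, map_one, LinearMap.sub_apply, Module.End.one_apply, symPolyHom_X, symOp_inr]
  congr 1

/-! ### Degree one -/

omit [Fact p.Prime] h𝒰 in
include hred in
/-- The nilpotent ideal `(p, red_τ(ϖ_τ))` of `O/pⁿ` used for the degree-one control. [folklore] -/
theorem exists_nilIdeal (τ₀ : K →+* E) :
    ∃ (I : Ideal (engCoeff p O n)) (m : ℕ), I ^ m • (⊤ : Submodule (engCoeff p O n) (SymCoeffLattice (engCoeff p O n) E K k)) = ⊥ ∧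
      (∀ τ, v τ = v τ₀ → engRed p O φO n τ ⟨_, uniformizerAt_mem_adicCompletionIntegers K (v τ)⟩ ∈ I) ∧
      ((p : ℕ) : engCoeff p O n) ∈ I := by
  classical
  set I : Ideal (engCoeff p O n) := Ideal.span (insert ((p : ℕ) : engCoeff p O n)
    (Set.range fun τ : K →+* E => engRed p O φO n τ ⟨_, uniformizerAt_mem_adicCompletionIntegers K (v τ)⟩)) with hI
  have hpS : ((p : ℕ) : engCoeff p O n) ^ n = 0 := by
    rw [← map_natCast (Ideal.Quotient.mk (Ideal.span {((p : O)) ^ n})) p, ← map_pow, Ideal.Quotient.eq_zero_iff_mem]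
    exact Ideal.mem_span_singleton_self _
  have hIfg : I.FG := Submodule.fg_span ((Set.finite_range _).insert _)
  have hIrad : I ≤ (⊥ : Ideal (engCoeff p O n)).radical := by
    refine Ideal.span_le.2 ?_
    rintro x (rfl | ⟨τ, rfl⟩)
    · exact ⟨n, by rw [hpS]; exact Submodule.zero_mem _⟩
    · exact ⟨lv n, by rw [engRed_uniformizer_pow_eq_zero O lv φO n hred τ]; exact Submodule.zero_mem _⟩
  obtain ⟨m, hm⟩ := Ideal.exists_pow_le_of_le_radical_of_fg hIrad hIfg
  refine ⟨I, m, ?_, fun τ _ => Ideal.subset_span (Set.mem_insert_of_mem _ ⟨τ, rfl⟩), Ideal.subset_span (Set.mem_insert _ _)⟩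
  rw [le_bot_iff.1 hm, Submodule.bot_smul]

include hb₁1 hlvn hred in
/-- **An ordinary `y ∈ H¹(W, Sym)` fixed by the `π(X_{d_q})` is `res` of an ordinary class of `H¹(U₀, Sym)`.**
[cite: KhareThorne2017, §6.3, Prop. 6.6, Lemma 6.10] [cite: Hida1994AIF, §3, Thm 3.2] -/
theorem exists_mem_levOrd_res_eq_one (τ₀ : K →+* E)
    (hfin : ∀ (cv : PlacesAbove K p → ℕ) (i : ℕ),
      Finite (cohomology (globalEmbedding 2 K) (integralMonoid K v) (engLatAction p O φO n k) (𝒰.depthLevel b₁ cv) i))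
    [Finite (cohomology (globalEmbedding 2 K) (integralMonoid K v) (engLatAction p O φO n k)
      (𝒰.level (max (lv n) 1) (max (lv n) 1)) 1)]
    (y : cohomology (globalEmbedding 2 K) (integralMonoid K v) (engLatAction p O φO n k) (𝒰.level (lv n) (max (lv n) 1)) 1)
    (hy : y ∈ 𝒰.levOrd O hv φO n k (lv n) (max (lv n) 1) 1)
    (hyq : ∀ q : 𝒰.level b₁ (max (lv n) 1) ⧸ (𝒰.level (max (lv n) 1) (max (lv n) 1)).subgroupOf (𝒰.level b₁ (max (lv n) 1)),
      𝒰.levPolyHom O hv φO n k c₀ (lv n) (max (lv n) 1) 1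
        (X (Sum.inr (𝒰.torusSection h𝒰.out hb₁ (hlvn.trans (le_max_left _ _)) (le_max_right _ _) q))) y = y) :
    ∃ x₀ ∈ 𝒰.levOrd O hv φO n k b₁ b₁ 1,
      (resCohomology (globalEmbedding 2 K) (integralMonoid K v) (engLatAction p O φO n k)
        (𝒰.level_antitone hlvn (hlvn.trans (le_max_left _ _)) : 𝒰.level (lv n) (max (lv n) 1) ≤ 𝒰.level b₁ b₁) 1).hom x₀ = y := by
  classical
  have h1 : 1 ≤ lv n := hb₁1.trans hlvn
  have hbc : b₁ ≤ max (lv n) 1 := hlvn.trans (le_max_left _ _)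
  have hc : 1 ≤ max (lv n) 1 := le_max_right _ _
  haveI := 𝒰.normal_subgroupOf_level h𝒰.out hbc hc
  haveI : Finite (cohomology (globalEmbedding 2 K) (integralMonoid K v) (engLatAction p O φO n k)
      (𝒰.level b₁ (max (lv n) 1)) 1) := hfin (fun _ => max (lv n) 1) 1
  have hWU : 𝒰.level (lv n) (max (lv n) 1) ≤ 𝒰.level (max (lv n) 1) (max (lv n) 1) :=
    𝒰.level_antitone (max_le le_rfl h1) le_rfl
  have hUW : 𝒰.level (max (lv n) 1) (max (lv n) 1) ≤ 𝒰.level (lv n) (max (lv n) 1) :=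
    𝒰.level_antitone (le_max_left _ _) le_rfl
  have hUU' : 𝒰.level (max (lv n) 1) (max (lv n) 1) ≤ 𝒰.level b₁ (max (lv n) 1) := 𝒰.level_antitone hbc le_rfl
  have hU'U₀ : 𝒰.level b₁ (max (lv n) 1) ≤ 𝒰.level b₁ b₁ := 𝒰.level_antitone le_rfl hbc
  -- the nilpotent ideal of the degree-one control
  obtain ⟨I, m, hI, hϖI, hpI⟩ := exists_nilIdeal O lv φO n hred k τ₀
  have hJ : (Fintype.card (ArithmeticQuotient.doubleCosetQuot (𝒰.level (max (lv n) 1) (max (lv n) 1))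
      (heckeElement 2 K (v τ₀) 1 ^ 1)) : engCoeff p O n) ∈ I := by
    obtain ⟨m', hm'⟩ := 𝒰.dvd_natCard_doubleCosetQuot_level h𝒰.out (hv τ₀) hc
    rw [← Nat.card_eq_fintype_card, hm', Nat.cast_mul]
    exact I.mul_mem_right _ hpI
  -- `y₁ := res_{W→U} y` is ordinary and fixed by the diamonds
  have hy₁ : (resCohomology (globalEmbedding 2 K) (integralMonoid K v) (engLatAction p O φO n k) hUW 1).hom y ∈
      𝒰.levOrd O hv φO n k (max (lv n) 1) (max (lv n) 1) 1 :=
    𝒰.resCohomology_mem_ordAtΔ hv (engLatAction p O φO n k) h𝒰.out hUW hc hc 1 hy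
  have hyq₁ : ∀ q, heckeCohomology (globalEmbedding 2 K) (integralMonoid K v) (engLatAction p O φO n k) (𝒰.level (max (lv n) 1) (max (lv n) 1))
      (𝒰.level_le_integralMonoid_of_forall_mem hv (max (lv n) 1) (max (lv n) 1)) ((𝒰.level_le_integralMonoid_of_forall_mem hv b₁ (max (lv n) 1)) (𝒰.torusSectionElt h𝒰.out hb₁ hbc hc q).2) 1
        ((resCohomology (globalEmbedding 2 K) (integralMonoid K v) (engLatAction p O φO n k) hUW 1).hom y) =
      (resCohomology (globalEmbedding 2 K) (integralMonoid K v) (engLatAction p O φO n k) hUW 1).hom y := fun q => by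
    have h := LinearMap.congr_fun (𝒰.resCohomology_comp_symOp hv (engLatAction p O φO n k) h𝒰.out (𝒰.level_le_integralMonoid_of_forall_mem hv (lv n) (max (lv n) 1)) (𝒰.level_le_integralMonoid_of_forall_mem hv (max (lv n) 1) (max (lv n) 1)) hUW hc hc c₀ 1
      (Sum.inr (𝒰.torusSection h𝒰.out hb₁ hbc hc q))) y
    rw [LinearMap.comp_apply, LinearMap.comp_apply, symOp_inr, symOp_inr] at h
    have hyW := hyq q
    rw [symPolyHom_X, symOp_inr] at hyW
    rw [hyW] at h
    exact h.symm
  -- B1/B2: `y₁ = res x` with `x` ordinary at `U'`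
  obtain ⟨x, hx, hxeq⟩ := 𝒰.exists_mem_ordAtΔ_resCohomology_eq k hv (engRed p O φO n) h𝒰.out hb₁ hbc hc (hv τ₀)
    (max_le le_rfl h1) hred I hI hϖI hJ _ hy₁ hyq₁
  -- Hida's bijection in degree one: `x = res x₀`
  have hbij := bijOn_resCohomology_ordAtΔ (ι := globalEmbedding 2 K) (Δ := integralMonoid K v) (τ := (engLatAction p O φO n k))
    (hΔ := fun w : PlacesAbove K p => heckeElement_mem_integralMonoid v w.1 1)
    (hUΔ := fun cv => 𝒰.depthLevel_le_integralMonoid_of_forall_mem hv b₁ cv) h𝒰.out hfin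
    (fun cv i w w' => 𝒰.commute_up_up_depthLevel h𝒰.out (engLatAction p O φO n k) (fun w : PlacesAbove K p => heckeElement_mem_integralMonoid v w.1 1)
      b₁ cv (𝒰.depthLevel_le_integralMonoid_of_forall_mem hv b₁ cv) i w w') hb₁1 le_rfl hbc 1
  obtain ⟨x₀, hx₀, hx₀eq⟩ := hbij.surjOn hx
  refine ⟨x₀, hx₀, ?_⟩
  have hyback : (resCohomology (globalEmbedding 2 K) (integralMonoid K v) (engLatAction p O φO n k) hWU 1).hom
      ((resCohomology (globalEmbedding 2 K) (integralMonoid K v) (engLatAction p O φO n k) hUW 1).hom y) = y :=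
    resCohomology_resCohomology_of_le_of_le (engLatAction p O φO n k) hWU hUW 1 y
  rw [← hyback, ← hxeq, ← hx₀eq]
  change _ = (resCohomology (globalEmbedding 2 K) (integralMonoid K v) (engLatAction p O φO n k) hWU 1).hom
    ((resCohomology (globalEmbedding 2 K) (integralMonoid K v) (engLatAction p O φO n k) hUU' 1).hom
      ((resCohomology (globalEmbedding 2 K) (integralMonoid K v) (engLatAction p O φO n k) hU'U₀ 1).hom x₀))
  rw [← resCohomology_hom_comp' hU'U₀ hUU' 1 x₀, ← resCohomology_hom_comp' (hUU'.trans hU'U₀) hWU 1 x₀]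

include hb₁ hb₁1 hred in
/-- **`res : Ord H¹(U₀, Sym) → H¹(W, Sym)` is injective.** [cite: KhareThorne2017, §6.3, Prop. 6.6, Lemma 6.10] -/
theorem injOn_res_base_one (τ₀ : K →+* E)
    (hfin : ∀ (cv : PlacesAbove K p → ℕ) (i : ℕ),
      Finite (cohomology (globalEmbedding 2 K) (integralMonoid K v) (engLatAction p O φO n k) (𝒰.depthLevel b₁ cv) i)) :
    Set.InjOn (resCohomology (globalEmbedding 2 K) (integralMonoid K v) (engLatAction p O φO n k)
        (𝒰.level_antitone hlvn (hlvn.trans (le_max_left _ _)) : 𝒰.level (lv n) (max (lv n) 1) ≤ 𝒰.level b₁ b₁) 1).hom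
      (𝒰.levOrd O hv φO n k b₁ b₁ 1 : Set _) := by
  classical
  have h1 : 1 ≤ lv n := hb₁1.trans hlvn
  have hbc : b₁ ≤ max (lv n) 1 := hlvn.trans (le_max_left _ _)
  have hc : 1 ≤ max (lv n) 1 := le_max_right _ _
  haveI := 𝒰.normal_subgroupOf_level h𝒰.out hbc hc
  haveI : Finite (cohomology (globalEmbedding 2 K) (integralMonoid K v) (engLatAction p O φO n k)
      (𝒰.level b₁ (max (lv n) 1)) 1) := hfin (fun _ => max (lv n) 1) 1
  have hWU : 𝒰.level (lv n) (max (lv n) 1) ≤ 𝒰.level (max (lv n) 1) (max (lv n) 1) :=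
    𝒰.level_antitone (max_le le_rfl h1) le_rfl
  have hUW : 𝒰.level (max (lv n) 1) (max (lv n) 1) ≤ 𝒰.level (lv n) (max (lv n) 1) :=
    𝒰.level_antitone (le_max_left _ _) le_rfl
  have hUU' : 𝒰.level (max (lv n) 1) (max (lv n) 1) ≤ 𝒰.level b₁ (max (lv n) 1) := 𝒰.level_antitone hbc le_rfl
  have hU'U₀ : 𝒰.level b₁ (max (lv n) 1) ≤ 𝒰.level b₁ b₁ := 𝒰.level_antitone le_rfl hbc
  obtain ⟨I, m, hI, hϖI, hpI⟩ := exists_nilIdeal O lv φO n hred k τ₀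
  have hJ : (Fintype.card (ArithmeticQuotient.doubleCosetQuot (𝒰.level (max (lv n) 1) (max (lv n) 1))
      (heckeElement 2 K (v τ₀) 1 ^ 1)) : engCoeff p O n) ∈ I := by
    obtain ⟨m', hm'⟩ := 𝒰.dvd_natCard_doubleCosetQuot_level h𝒰.out (hv τ₀) hc
    rw [← Nat.card_eq_fintype_card, hm', Nat.cast_mul]
    exact I.mul_mem_right _ hpI
  have hbij := bijOn_resCohomology_ordAtΔ (ι := globalEmbedding 2 K) (Δ := integralMonoid K v) (τ := (engLatAction p O φO n k))
    (hΔ := fun w : PlacesAbove K p => heckeElement_mem_integralMonoid v w.1 1)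
    (hUΔ := fun cv => 𝒰.depthLevel_le_integralMonoid_of_forall_mem hv b₁ cv) h𝒰.out hfin
    (fun cv i w w' => 𝒰.commute_up_up_depthLevel h𝒰.out (engLatAction p O φO n k) (fun w : PlacesAbove K p => heckeElement_mem_integralMonoid v w.1 1)
      b₁ cv (𝒰.depthLevel_le_integralMonoid_of_forall_mem hv b₁ cv) i w w') hb₁1 le_rfl hbc 1
  have hinj' := 𝒰.injOn_resCohomology_ordAtΔ_one k hv (engRed p O φO n) h𝒰.out hb₁ hbc hc (hv τ₀)
    (max_le le_rfl h1) hred I hI hϖI hJ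
  intro x₀ hx₀ x₀' hx₀' heq
  -- peel off `res_{U→W}` (it has a left inverse), then the two injectivity statements
  have hcomp : ∀ z : cohomology (globalEmbedding 2 K) (integralMonoid K v) (engLatAction p O φO n k) (𝒰.level b₁ b₁) 1,
      (resCohomology (globalEmbedding 2 K) (integralMonoid K v) (engLatAction p O φO n k)
          (𝒰.level_antitone hlvn (hlvn.trans (le_max_left _ _)) : 𝒰.level (lv n) (max (lv n) 1) ≤ 𝒰.level b₁ b₁) 1).hom z =
        (resCohomology (globalEmbedding 2 K) (integralMonoid K v) (engLatAction p O φO n k) hWU 1).hom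
          ((resCohomology (globalEmbedding 2 K) (integralMonoid K v) (engLatAction p O φO n k) hUU' 1).hom
            ((resCohomology (globalEmbedding 2 K) (integralMonoid K v) (engLatAction p O φO n k) hU'U₀ 1).hom z)) := fun z => by
    rw [← resCohomology_hom_comp' hU'U₀ hUU' 1 z, ← resCohomology_hom_comp' (hUU'.trans hU'U₀) hWU 1 z]
  rw [hcomp, hcomp] at heq
  have heq' := congrArg (resCohomology (globalEmbedding 2 K) (integralMonoid K v) (engLatAction p O φO n k) hUW 1).hom heq
  rw [resCohomology_resCohomology_of_le_of_le (engLatAction p O φO n k) hUW hWU 1, resCohomology_resCohomology_of_le_of_le (engLatAction p O φO n k) hUW hWU 1] at heq'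
  exact hbij.injOn hx₀ hx₀' (hinj' (hbij.mapsTo hx₀) (hbij.mapsTo hx₀') heq')

end Engine

end TameLevel

end BigHeckeGLn

end Literature.NumberTheory.Automorphic
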